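import Mathlib
import HarnessLib

/-!
# The rung-2 strain sector: the 2-jet invariant `Ψ = |a₀|^{14/5}/a₂ = R·|a₀|^{4/5}` and a no-blow-up criterion for the centre strain
(Negative lane bookkeeping, supports `RungBlowupCofinal` / BC5 rung 2; circuit seat g9; sequel to `StrainSectorCentreJet.lean`)

MODEL, NOT NS.  Centre 2-jet rows of the m = 0 strain sector of `NS₂` (no swirl): `ȧ₀ = −(15/14)a₀² + 14ν a₂`, `ȧ₂ = −3a₀a₂ + 36ν a₄`
(`StrainSectorCentreJet` §1).  For a compression germ `a₀ < 0 < a₂` put `R = a₀²/a₂ = |a₀|ℓ²`, `σ = a₀a₄/a₂²` and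

  `Ψ := a₀² · (a₀²)^{2/5} / a₂ = |a₀|^{14/5}/a₂ = R · |a₀|^{4/5}`.

* `hasDerivAt_jetInvariant` : **`Ψ̇ = Ψ · ν(196 a₂/(5a₀) − 36 a₄/a₂) = Ψ · (36σ − 196/5)·ν/ℓ²`** — at `ν = 0`, `Ψ` is the EXACT FIRST INTEGRAL of
  the 2-jet (`R ∝ |a₀|^{−4/5}`, `StrainSectorCentreJet.collapseReynolds_explicit`); with viscosity it grows only while the flatness exceeds
  `49/45 = (196/5)/36` (`jetInvariant_rate_eq`, `jetInvariant_antitone_of_flatness_le`);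
* `centreStrain_bounded_of_flatness_le` : **if `σ ≤ 49/45` along a solution arc on `[0, T]` (with `a₀ < 0 < a₂`), then
  `|a₀(t)| ≤ max(|a₀(0)|, (15Ψ(0)/(196ν))^{5/4})` for all `t` — NO blow-up of the centre strain**: since `Ψ` does not increase,
  `R(t) ≤ Ψ(0)|a₀(t)|^{−4/5}` drops below the amplification threshold `196ν/15` (`StrainSectorCentreLaw.centreLaw_amplifies_iff`) as soon as
  `|a₀|` exceeds `(15Ψ(0)/(196ν))^{5/4}`, and there `d|a₀|/dt ≤ 0` (a barrier, by real induction on `[0, T]`);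
* `centreStrain_bounded_of_jetInvariant_le` : the same barrier WITHOUT any flatness hypothesis — **any bound `Ψ ≤ C` on `[0, T]` gives
  `|a₀(t)| ≤ max(|a₀(0)|, (15C/(196ν))^{5/4})`**: the centre strain of the sector is controlled by `sup Ψ` alone, so a sector blow-up
  is exactly a divergence of the 2-jet invariant (v2 append).

Reading (MODEL): a Type-I lock of the sector needs `Ψ → ∞`, i.e. flatness above `49/45` INTEGRATED against the viscous rate `ν/ℓ²` must diverge;
SIGMA-INFER (HOME/circuit/agl/probe/sigma_infer.py on SECTOR-1c) reads `Ψ` growing by a finite factor (`Ψ_turn/Ψ₀` = 0.69 at A = 20, 3.04 at A = 100, 51.7 at A = 1000 (N 2000)) during the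
flat phase `σ ≤ 1.5` and the turn at `R = 196/15`, `σ → 49/45⁻`.  Whether the sector PDE can drive `Ψ → ∞` is OPEN (not a jet question).
Nothing here asserts a Theses declaration.
-/

namespace Summit.NavierStokesRegularity.RungBlowupCofinalStrainSectorJetInvariant

open Set Filter Topology

/-! ### §1 The 2-jet invariant -/

/-- **Rate of the 2-jet invariant.**  Along the viscous 2-jet rows (`ȧ₀ = −(15/14)a₀² + 14νa₂`, `ȧ₂ = −3a₀a₂ + 36νa₄`, within a time set `D`)
with `a₀(t) ≠ 0`, `a₂(t) ≠ 0`: `Ψ = a₀²(a₀²)^{2/5}/a₂` has derivative `Ψ · ν(196a₂/(5a₀) − 36a₄/a₂)` — zero at `ν = 0`. -/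
theorem hasDerivWithinAt_jetInvariant {ν : ℝ} {a0 a2 a4 : ℝ → ℝ} {D : Set ℝ} {t : ℝ}
    (h0 : HasDerivWithinAt a0 (-(15 / 14) * a0 t ^ 2 + 14 * ν * a2 t) D t)
    (h2 : HasDerivWithinAt a2 (-3 * a0 t * a2 t + 36 * ν * a4 t) D t) (ha0 : a0 t ≠ 0) (ha2 : a2 t ≠ 0) :
    HasDerivWithinAt (fun s => a0 s ^ 2 * (a0 s ^ 2) ^ ((2 / 5 : ℝ)) / a2 s)
      ((a0 t ^ 2 * (a0 t ^ 2) ^ ((2 / 5 : ℝ)) / a2 t) * (ν * ((196 / 5) * a2 t / a0 t - 36 * a4 t / a2 t))) D t := by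
  have hsq : HasDerivWithinAt (fun s => a0 s ^ 2) (2 * a0 t * (-(15 / 14) * a0 t ^ 2 + 14 * ν * a2 t)) D t := by
    have h := h0.fun_pow 2
    refine h.congr_deriv ?_
    push_cast
    ring
  have hpos : 0 < a0 t ^ 2 := by positivity
  have hr := hsq.rpow_const (p := (2 / 5 : ℝ)) (Or.inl hpos.ne')
  have h := (hsq.fun_mul hr).fun_div h2 ha2
  refine h.congr_deriv ?_
  have hsplit : (a0 t ^ 2) ^ ((2 / 5 : ℝ) - 1) = (a0 t ^ 2) ^ ((2 / 5 : ℝ)) / a0 t ^ 2 := Real.rpow_sub_one hpos.ne' _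
  rw [hsplit]
  set Y := (a0 t ^ 2) ^ ((2 / 5 : ℝ)) with hY
  field_simp
  ring

/-- **The same rate in germ variables**: with `ℓ² = −a₀/a₂`, `σ = a₀a₄/a₂²`,
`ν(196a₂/(5a₀) − 36a₄/a₂) = (36σ − 196/5)·ν/ℓ²`; in particular it is `≤ 0` iff `σ ≤ 49/45` (for `ν > 0`, `ℓ² > 0`). -/
theorem jetInvariant_rate_eq {ν a0 a2 a4 : ℝ} (ha0 : a0 ≠ 0) (ha2 : a2 ≠ 0) :
    ν * ((196 / 5) * a2 / a0 - 36 * a4 / a2) = (36 * (a0 * a4 / a2 ^ 2) - 196 / 5) * ν / (-a0 / a2) := by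
  field_simp
  ring

/-- **`Ψ` does not increase while the flatness stays `≤ 49/45`.**  On a closed interval `[T₁, T₂]` (one-sided derivatives within it), along
the viscous 2-jet rows with `a₀ < 0 < a₂`, `ν ≥ 0` and `σ = a₀a₄/a₂² ≤ 49/45`, the invariant `Ψ = a₀²(a₀²)^{2/5}/a₂` is antitone. -/
theorem jetInvariant_antitoneOn_of_flatness_le {ν : ℝ} {a0 a2 a4 : ℝ → ℝ} {T₁ T₂ : ℝ} (hν : 0 ≤ ν)
    (h0 : ∀ t ∈ Icc T₁ T₂, HasDerivWithinAt a0 (-(15 / 14) * a0 t ^ 2 + 14 * ν * a2 t) (Icc T₁ T₂) t)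
    (h2 : ∀ t ∈ Icc T₁ T₂, HasDerivWithinAt a2 (-3 * a0 t * a2 t + 36 * ν * a4 t) (Icc T₁ T₂) t)
    (hneg : ∀ t ∈ Icc T₁ T₂, a0 t < 0) (hpos : ∀ t ∈ Icc T₁ T₂, 0 < a2 t)
    (hflat : ∀ t ∈ Icc T₁ T₂, a0 t * a4 t / a2 t ^ 2 ≤ 49 / 45) :
    AntitoneOn (fun s => a0 s ^ 2 * (a0 s ^ 2) ^ ((2 / 5 : ℝ)) / a2 s) (Icc T₁ T₂) := by
  have hD : ∀ t ∈ Icc T₁ T₂, HasDerivWithinAt (fun s => a0 s ^ 2 * (a0 s ^ 2) ^ ((2 / 5 : ℝ)) / a2 s)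
      ((a0 t ^ 2 * (a0 t ^ 2) ^ ((2 / 5 : ℝ)) / a2 t) * (ν * ((196 / 5) * a2 t / a0 t - 36 * a4 t / a2 t))) (Icc T₁ T₂) t :=
    fun t ht => hasDerivWithinAt_jetInvariant (h0 t ht) (h2 t ht) (hneg t ht).ne (hpos t ht).ne'
  refine antitoneOn_of_hasDerivWithinAt_nonpos (convex_Icc T₁ T₂) (fun t ht => (hD t ht).continuousWithinAt)
    (fun t ht => (hD t (interior_subset ht)).mono interior_subset) ?_
  intro t ht
  have ht' := interior_subset ht
  have hΨ : 0 < a0 t ^ 2 * (a0 t ^ 2) ^ ((2 / 5 : ℝ)) / a2 t := by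
    have : 0 < a0 t ^ 2 := by nlinarith [hneg t ht']
    exact div_pos (mul_pos this (Real.rpow_pos_of_pos this _)) (hpos t ht')
  have hrate : ν * ((196 / 5) * a2 t / a0 t - 36 * a4 t / a2 t) ≤ 0 := by
    rw [jetInvariant_rate_eq (hneg t ht').ne (hpos t ht').ne']
    have hl : 0 < -a0 t / a2 t := div_pos (by linarith [hneg t ht']) (hpos t ht')
    apply div_nonpos_of_nonpos_of_nonneg _ hl.le
    have : 36 * (a0 t * a4 t / a2 t ^ 2) - 196 / 5 ≤ 0 := by linarith [hflat t ht']
    nlinarith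
  exact mul_nonpos_of_nonneg_of_nonpos hΨ.le hrate

/-! ### §2 No blow-up of the centre strain under the flatness bound -/

/-- Real induction with a right-derivative barrier: if `y` is continuous on `[a, b]`, `y(a) ≥ c`, and at every `x ∈ [a, b)` with `y(x) = c`
the function has a one-sided derivative within `[a, b]` that is POSITIVE, then `y ≥ c` on `[a, b]`. -/
private theorem le_of_barrier {y y' : ℝ → ℝ} {a b c : ℝ} (hcont : ContinuousOn y (Icc a b)) (ha : c ≤ y a)
    (hder : ∀ x ∈ Ico a b, y x = c → HasDerivWithinAt y (y' x) (Icc a b) x ∧ 0 < y' x) :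
    ∀ t ∈ Icc a b, c ≤ y t := by
  rcases lt_or_ge b a with hab | hab
  · intro t ht
    exact absurd (ht.1.trans ht.2) (not_le.2 hab)
  let s : Set ℝ := {t | c ≤ y t} ∪ (Icc a b)ᶜ
  have hs : IsClosed (s ∩ Icc a b) := by
    have : s ∩ Icc a b = {t | c ≤ y t} ∩ Icc a b := by
      ext t
      constructor
      · rintro ⟨ht | ht, htI⟩
        · exact ⟨ht, htI⟩
        · exact absurd htI ht
      · rintro ⟨ht, htI⟩
        exact ⟨Or.inl ht, htI⟩
    rw [this, Set.inter_comm]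
    exact hcont.preimage_isClosed_of_isClosed isClosed_Icc isClosed_Ici
  have key := IsClosed.Icc_subset_of_forall_mem_nhdsWithin hs (Or.inl ha) ?_
  · intro t ht
    rcases key ht with h | h
    · exact h
    · exact absurd ht h
  rintro x ⟨hx, hxI⟩
  have hxc : c ≤ y x := by
    rcases hx with h | h
    · exact h
    · exact absurd (Ico_subset_Icc_self hxI) h
  have hIoo : 𝓝[Ioo x b] x = 𝓝[>] x := nhdsWithin_Ioo_eq_nhdsGT hxI.2
  rcases hxc.lt_or_eq with hlt | heq
  · -- strict: by continuity within [a,b]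
    have hc' : ContinuousWithinAt y (Icc a b) x := hcont x (Ico_subset_Icc_self hxI)
    have hev : ∀ᶠ t in 𝓝[Icc a b] x, c < y t := hc'.eventually (Ioi_mem_nhds hlt)
    have hsub : Ioo x b ⊆ Icc a b := fun t ht => ⟨hxI.1.trans ht.1.le, ht.2.le⟩
    have hev' : ∀ᶠ t in 𝓝[Ioo x b] x, c < y t := nhdsWithin_mono x hsub hev
    rw [hIoo] at hev'
    filter_upwards [hev'] with t ht
    left
    show c ≤ y t
    exact le_of_lt ht
  · -- touching the barrier: positive right derivative
    obtain ⟨hd, hpos⟩ := hder x hxI heq.symm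
    have hd' : HasDerivWithinAt y (y' x) (Ioo x b) x := hd.mono fun t ht => ⟨hxI.1.trans ht.1.le, ht.2.le⟩
    have hsl := (hasDerivWithinAt_iff_tendsto_slope' (show x ∉ Ioo x b from fun h => lt_irrefl x h.1)).1 hd'
    have hev : ∀ᶠ t in 𝓝[Ioo x b] x, 0 < slope y x t := hsl.eventually (Ioi_mem_nhds hpos)
    have hev2 : ∀ᶠ t in 𝓝[Ioo x b] x, t ∈ Ioo x b := self_mem_nhdsWithin
    rw [hIoo] at hev hev2
    filter_upwards [hev, hev2] with t ht htI
    left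
    show c ≤ y t
    have hslope : slope y x t = (y t - y x) / (t - x) := by
      rw [slope_def_field]
    rw [hslope] at ht
    have htx : 0 < t - x := by linarith [htI.1]
    have : 0 < y t - y x := by
      by_contra hle
      have hle : y t - y x ≤ 0 := le_of_not_gt hle
      have := div_nonpos_of_nonpos_of_nonneg hle htx.le
      linarith
    linarith

/-- **No blow-up of the centre strain while the flatness stays `≤ 49/45`.**  Along the viscous 2-jet rows on `[0, T]` (`ν > 0`) with
`a₀ < 0 < a₂` and `σ = a₀a₄/a₂² ≤ 49/45` throughout,
`|a₀(t)| ≤ max(|a₀(0)|, (15Ψ₀/(196ν))^{5/4})` for every `t ∈ [0, T]`, where `Ψ₀ = a₀(0)²(a₀(0)²)^{2/5}/a₂(0)`.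
(Barrier: `Ψ ≤ Ψ₀` by `jetInvariant_antitoneOn_of_flatness_le`; where `|a₀| = K > (15Ψ₀/(196ν))^{5/4}` one has
`R = a₀²/a₂ = Ψ/|a₀|^{4/5} < 196ν/15`, hence `d(−1/a₀)/dt = 14νa₂/a₀² − 15/14 = 14ν/R − 15/14 > 0`.) -/
theorem centreStrain_bounded_of_flatness_le {ν : ℝ} {a0 a2 a4 : ℝ → ℝ} {T : ℝ} (hν : 0 < ν)
    (h0 : ∀ t ∈ Icc 0 T, HasDerivWithinAt a0 (-(15 / 14) * a0 t ^ 2 + 14 * ν * a2 t) (Icc 0 T) t)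
    (h2 : ∀ t ∈ Icc 0 T, HasDerivWithinAt a2 (-3 * a0 t * a2 t + 36 * ν * a4 t) (Icc 0 T) t)
    (hneg : ∀ t ∈ Icc 0 T, a0 t < 0) (hpos : ∀ t ∈ Icc 0 T, 0 < a2 t)
    (hflat : ∀ t ∈ Icc 0 T, a0 t * a4 t / a2 t ^ 2 ≤ 49 / 45) {t : ℝ} (ht : t ∈ Icc 0 T) :
    |a0 t| ≤ max |a0 0| ((15 * (a0 0 ^ 2 * (a0 0 ^ 2) ^ ((2 / 5 : ℝ)) / a2 0) / (196 * ν)) ^ ((5 / 4 : ℝ))) := by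
  set Ψ0 := a0 0 ^ 2 * (a0 0 ^ 2) ^ ((2 / 5 : ℝ)) / a2 0 with hΨ0
  set Mstar := (15 * Ψ0 / (196 * ν)) ^ ((5 / 4 : ℝ)) with hM
  have h0T : (0 : ℝ) ∈ Icc 0 T := left_mem_Icc.2 (ht.1.trans ht.2)
  have hΨ0pos : 0 < Ψ0 := by
    have : 0 < a0 0 ^ 2 := by nlinarith [hneg 0 h0T]
    exact div_pos (mul_pos this (Real.rpow_pos_of_pos this _)) (hpos 0 h0T)
  have hMpos : 0 < Mstar := Real.rpow_pos_of_pos (by positivity) _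
  have hanti := jetInvariant_antitoneOn_of_flatness_le hν.le h0 h2 hneg hpos hflat
  -- it suffices to beat every K > max
  suffices hK : ∀ K, max |a0 0| Mstar < K → |a0 t| ≤ K by
    by_contra hlt
    have hlt : max |a0 0| Mstar < |a0 t| := lt_of_not_ge hlt
    have := hK ((max |a0 0| Mstar + |a0 t|) / 2) (by linarith)
    linarith
  intro K hK
  have hKpos : 0 < K := lt_of_le_of_lt (le_max_right _ _ |>.trans' hMpos.le) hK
  -- barrier for y = -1/a0 ≥ 1/K
  have hy : ∀ s ∈ Icc 0 T, 1 / K ≤ -(a0 s)⁻¹ := by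
    refine le_of_barrier (y := fun s => -(a0 s)⁻¹) (y' := fun s => (-(15 / 14) * a0 s ^ 2 + 14 * ν * a2 s) / a0 s ^ 2)
      (fun s hs => (((h0 s hs).inv (hneg s hs).ne).neg).continuousWithinAt) ?_ ?_
    · -- at s = 0: |a0 0| ≤ max ≤ K
      have ha0 : |a0 0| < K := lt_of_le_of_lt (le_max_left _ _) hK
      rw [abs_of_neg (hneg 0 h0T)] at ha0
      have hneg0 := hneg 0 h0T
      have hne0 : a0 0 ≠ 0 := hneg0.ne
      rw [show -(a0 0)⁻¹ = 1 / (-a0 0) by field_simp]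
      exact one_div_le_one_div_of_le (by linarith) ha0.le
    · intro x hx hyx
      have hxI : x ∈ Icc 0 T := Ico_subset_Icc_self hx
      refine ⟨((h0 x hxI).inv (hneg x hxI).ne).neg.congr_deriv (by ring), ?_⟩
      -- at the barrier |a0 x| = K > Mstar, so R < 196ν/15 and the derivative is positive
      have hax : a0 x = -K := by
        have hK0 : K ≠ 0 := hKpos.ne'
        have ha : a0 x ≠ 0 := (hneg x hxI).ne
        field_simp at hyx
        linarith
      have hΨle : a0 x ^ 2 * (a0 x ^ 2) ^ ((2 / 5 : ℝ)) / a2 x ≤ Ψ0 := hanti h0T hxI hx.1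
      have hKM : Mstar < K := lt_of_le_of_lt (le_max_right _ _) hK
      -- K^{4/5} > 15 Ψ0 /(196 ν)
      have hK45 : 15 * Ψ0 / (196 * ν) < (K ^ 2) ^ ((2 / 5 : ℝ)) := by
        have h1 : (15 * Ψ0 / (196 * ν)) = Mstar ^ ((4 / 5 : ℝ)) := by
          rw [hM, ← Real.rpow_mul (by positivity)]
          norm_num
        have h2 : (K ^ 2) ^ ((2 / 5 : ℝ)) = K ^ ((4 / 5 : ℝ)) := by
          rw [← Real.rpow_natCast K 2, ← Real.rpow_mul hKpos.le]
          norm_num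
        rw [h1, h2]
        exact Real.rpow_lt_rpow hMpos.le hKM (by norm_num)
      have ha2x := hpos x hxI
      -- a2 x > (15/(196 ν)) K² i.e. 14 ν a2 > (15/14) K²
      have hK2 : 0 < K ^ 2 := by positivity
      have hY : 0 < (K ^ 2) ^ ((2 / 5 : ℝ)) := Real.rpow_pos_of_pos hK2 _
      have hΨle' : K ^ 2 * (K ^ 2) ^ ((2 / 5 : ℝ)) ≤ Ψ0 * a2 x := by
        rw [hax] at hΨle
        have h' : (-K) ^ 2 * ((-K) ^ 2) ^ ((2 / 5 : ℝ)) ≤ Ψ0 * a2 x := (div_le_iff₀ ha2x).1 hΨle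
        have hnk : (-K) ^ 2 = K ^ 2 := by ring
        rw [hnk] at h'
        exact h'
      have e1 : 15 * Ψ0 < (K ^ 2) ^ ((2 / 5 : ℝ)) * (196 * ν) := (div_lt_iff₀ (by positivity)).1 hK45
      have e2 : 15 * Ψ0 * K ^ 2 < (K ^ 2) ^ ((2 / 5 : ℝ)) * (196 * ν) * K ^ 2 := mul_lt_mul_of_pos_right e1 hK2
      have e3 : 196 * ν * (K ^ 2 * (K ^ 2) ^ ((2 / 5 : ℝ))) ≤ 196 * ν * (Ψ0 * a2 x) :=
        mul_le_mul_of_nonneg_left hΨle' (by positivity)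
      have e4 : Ψ0 * (15 * K ^ 2) < Ψ0 * (196 * ν * a2 x) := by nlinarith [e2, e3]
      have e5 : 15 * K ^ 2 < 196 * ν * a2 x := lt_of_mul_lt_mul_left e4 hΨ0pos.le
      have hcmp : (15 / 14) * K ^ 2 < 14 * ν * a2 x := by nlinarith [e5]
      have hsq : 0 < a0 x ^ 2 := by rw [sq]; exact mul_pos_of_neg_of_neg (hneg x hxI) (hneg x hxI)
      have : 0 < (-(15 / 14) * a0 x ^ 2 + 14 * ν * a2 x) := by rw [hax]; nlinarith [hcmp]
      exact div_pos this hsq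
  have hyt := hy t ht
  have hneg_t := hneg t ht
  rw [abs_of_neg hneg_t]
  have hnet : a0 t ≠ 0 := hneg_t.ne
  rw [show -(a0 t)⁻¹ = 1 / (-a0 t) by field_simp] at hyt
  have hpos_t : 0 < -a0 t := by linarith
  have := (one_div_le_one_div hKpos hpos_t).1 hyt
  linarith

/-- **The centre strain is controlled by `sup Ψ` (no flatness hypothesis).**  Along the viscous 2-jet rows on `[0, T]` (`ν > 0`) with
`a₀ < 0 < a₂`, ANY bound `Ψ(s) = a₀(s)²(a₀(s)²)^{2/5}/a₂(s) ≤ C` on `[0, T]` gives `|a₀(t)| ≤ max(|a₀(0)|, (15C/(196ν))^{5/4})`.  Hence a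
blow-up of the centre strain in the sector forces `Ψ = |a₀|^{9/5}ℓ² → ∞` — by `hasDerivWithinAt_jetInvariant`, flatness above `49/45`
integrated against `ν/ℓ²` must diverge. -/
theorem centreStrain_bounded_of_jetInvariant_le {ν C : ℝ} {a0 a2 : ℝ → ℝ} {T : ℝ} (hν : 0 < ν) (hC : 0 < C)
    (h0 : ∀ t ∈ Icc 0 T, HasDerivWithinAt a0 (-(15 / 14) * a0 t ^ 2 + 14 * ν * a2 t) (Icc 0 T) t)
    (hneg : ∀ t ∈ Icc 0 T, a0 t < 0) (hpos : ∀ t ∈ Icc 0 T, 0 < a2 t)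
    (hΨ : ∀ t ∈ Icc 0 T, a0 t ^ 2 * (a0 t ^ 2) ^ ((2 / 5 : ℝ)) / a2 t ≤ C) {t : ℝ} (ht : t ∈ Icc 0 T) :
    |a0 t| ≤ max |a0 0| ((15 * C / (196 * ν)) ^ ((5 / 4 : ℝ))) := by
  set Mstar := (15 * C / (196 * ν)) ^ ((5 / 4 : ℝ)) with hM
  have h0T : (0 : ℝ) ∈ Icc 0 T := left_mem_Icc.2 (ht.1.trans ht.2)
  have hMpos : 0 < Mstar := Real.rpow_pos_of_pos (by positivity) _
  suffices hK : ∀ K, max |a0 0| Mstar < K → |a0 t| ≤ K by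
    by_contra hlt
    have hlt : max |a0 0| Mstar < |a0 t| := lt_of_not_ge hlt
    have := hK ((max |a0 0| Mstar + |a0 t|) / 2) (by linarith)
    linarith
  intro K hK
  have hKpos : 0 < K := lt_of_le_of_lt (le_max_right _ _ |>.trans' hMpos.le) hK
  have hy : ∀ s ∈ Icc 0 T, 1 / K ≤ -(a0 s)⁻¹ := by
    refine le_of_barrier (y := fun s => -(a0 s)⁻¹) (y' := fun s => (-(15 / 14) * a0 s ^ 2 + 14 * ν * a2 s) / a0 s ^ 2)
      (fun s hs => (((h0 s hs).inv (hneg s hs).ne).neg).continuousWithinAt) ?_ ?_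
    · have ha0 : |a0 0| < K := lt_of_le_of_lt (le_max_left _ _) hK
      rw [abs_of_neg (hneg 0 h0T)] at ha0
      have hneg0 := hneg 0 h0T
      have hne0 : a0 0 ≠ 0 := hneg0.ne
      rw [show -(a0 0)⁻¹ = 1 / (-a0 0) by field_simp]
      exact one_div_le_one_div_of_le (by linarith) ha0.le
    · intro x hx hyx
      have hxI : x ∈ Icc 0 T := Ico_subset_Icc_self hx
      refine ⟨((h0 x hxI).inv (hneg x hxI).ne).neg.congr_deriv (by ring), ?_⟩
      have hax : a0 x = -K := by
        have hK0 : K ≠ 0 := hKpos.ne'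
        have ha : a0 x ≠ 0 := (hneg x hxI).ne
        field_simp at hyx
        linarith
      have hΨle : a0 x ^ 2 * (a0 x ^ 2) ^ ((2 / 5 : ℝ)) / a2 x ≤ C := hΨ x hxI
      have hKM : Mstar < K := lt_of_le_of_lt (le_max_right _ _) hK
      have hK45 : 15 * C / (196 * ν) < (K ^ 2) ^ ((2 / 5 : ℝ)) := by
        have h1 : (15 * C / (196 * ν)) = Mstar ^ ((4 / 5 : ℝ)) := by
          rw [hM, ← Real.rpow_mul (by positivity)]
          norm_num
        have h2 : (K ^ 2) ^ ((2 / 5 : ℝ)) = K ^ ((4 / 5 : ℝ)) := by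
          rw [← Real.rpow_natCast K 2, ← Real.rpow_mul hKpos.le]
          norm_num
        rw [h1, h2]
        exact Real.rpow_lt_rpow hMpos.le hKM (by norm_num)
      have ha2x := hpos x hxI
      have hK2 : 0 < K ^ 2 := by positivity
      have hY : 0 < (K ^ 2) ^ ((2 / 5 : ℝ)) := Real.rpow_pos_of_pos hK2 _
      have hΨle' : K ^ 2 * (K ^ 2) ^ ((2 / 5 : ℝ)) ≤ C * a2 x := by
        rw [hax] at hΨle
        have h' : (-K) ^ 2 * ((-K) ^ 2) ^ ((2 / 5 : ℝ)) ≤ C * a2 x := (div_le_iff₀ ha2x).1 hΨle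
        have hnk : (-K) ^ 2 = K ^ 2 := by ring
        rw [hnk] at h'
        exact h'
      have e1 : 15 * C < (K ^ 2) ^ ((2 / 5 : ℝ)) * (196 * ν) := (div_lt_iff₀ (by positivity)).1 hK45
      have e2 : 15 * C * K ^ 2 < (K ^ 2) ^ ((2 / 5 : ℝ)) * (196 * ν) * K ^ 2 := mul_lt_mul_of_pos_right e1 hK2
      have e3 : 196 * ν * (K ^ 2 * (K ^ 2) ^ ((2 / 5 : ℝ))) ≤ 196 * ν * (C * a2 x) :=
        mul_le_mul_of_nonneg_left hΨle' (by positivity)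
      have e4 : C * (15 * K ^ 2) < C * (196 * ν * a2 x) := by nlinarith [e2, e3]
      have e5 : 15 * K ^ 2 < 196 * ν * a2 x := lt_of_mul_lt_mul_left e4 hC.le
      have hcmp : (15 / 14) * K ^ 2 < 14 * ν * a2 x := by nlinarith [e5]
      have hsq : 0 < a0 x ^ 2 := by rw [sq]; exact mul_pos_of_neg_of_neg (hneg x hxI) (hneg x hxI)
      have : 0 < (-(15 / 14) * a0 x ^ 2 + 14 * ν * a2 x) := by rw [hax]; nlinarith [hcmp]
      exact div_pos this hsq
  have hyt := hy t ht
  have hneg_t := hneg t ht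
  rw [abs_of_neg hneg_t]
  have hnet : a0 t ≠ 0 := hneg_t.ne
  rw [show -(a0 t)⁻¹ = 1 / (-a0 t) by field_simp] at hyt
  have hpos_t : 0 < -a0 t := by linarith
  have := (one_div_le_one_div hKpos hpos_t).1 hyt
  linarith

end Summit.NavierStokesRegularity.RungBlowupCofinalStrainSectorJetInvariant
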